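import Mathlib
import Summits.PneNP.PneNP.Theorems.SymmetryBudgetWindowBarrierESTArith
import Summits.PneNP.PneNP.Theorems.SymmetryBudgetWindowBarrierESTNormal
import Summits.PneNP.PneNP.Theorems.SymmetryBudgetWindowBarrierESTTransitive

/-!
# Entropy support theorem (assembly): stub `entropySupportTheorem` of crux `SymmetryBudget.WindowBarrier`

Item stmt-PneNP-2145, line `bijection-gauge-twin-iso`, registered stub `entropySupportTheorem` (a
subgroup `H ≤ Sym(n)` of index `≤ 2^{cn}` contains `∏ Alt(class)` for a labelling of the points whose
multinomial is `≤ 2^{Kn}`, `K = 2c + 5`), assembled from the landed layers `…ESTArith`, `…ESTNormal`,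
`…ESTLinkage`, `…ESTBlocks`, `…ESTTransport`, `…ESTTransitive`:
* `EST.pair_bound` — **general pair bound**, strong induction on the degree: for `L ≤ G ≤ Sym(β)`, `L`
  normalised by `G`, some labelling `μ` has every even permutation with monochromatic moved points
  in `L` and `|G|·|L| ≤ 2^{5|β|}·|β|!·∏|class|!`.  Transitive case = `est_transitive_pair_bound`
  (`T = X = G`, `Y = Z = L`).  Otherwise split `β = O ⊔ Oᶜ` along an orbit `O` of `G`; with `G_(S)`
  the pointwise stabiliser, `|G|·|L| = (|L|_O|·|G_(Oᶜ)|_O|)·(|G|_{Oᶜ}|·|L_(O)|_{Oᶜ}|)`; the first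
  factor is the transitive bound on `O` (`X = L|_O`, `Y = G_(Oᶜ)|_O`, `Z = (L ∩ G_(Oᶜ))|_O ⊇ [X,Y]`),
  the second the induction hypothesis on `Oᶜ` (`G|_{Oᶜ} ⊵ L_(O)|_{Oᶜ}`); labellings are glued by
  `EST.exists_combined_labelling`, and monochromatic even permutations are supported in `O` or in
  `Oᶜ`, where they lift to `L ∩ G_(Oᶜ)` resp. `L_(O)`.
* `entropySupportTheorem` — the registered signature, from `pair_bound` with `G = L = H`:
  `(n!)² = ([Sym : H]·|H|)² ≤ 2^{2cn}|H|² ≤ 2^{(2c+5)n}·n!·∏|class|!`.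
No definitions, no `sorry` (kernel-only file).
-/
-- `Summit.PneNP.PneNP.…` duplicates `PneNP` BY DESIGN (single-problem summit).
set_option linter.dupNamespace false

namespace Summit.PneNP.PneNP.Theorems

open Equiv Equiv.Perm MulAction Subgroup
open Literature.GroupTheory.PermutationGroups (restr restr_apply_coe perm_apply_inv_self
  perm_inv_apply_self)

namespace EST

universe u

section Restriction

variable {β : Type*}

/-- Restricting an element of `S ≤ G` through `S` or through `G` gives the same permutation. -/
theorem restr_mk_eq_restr_mk {S G : Subgroup (Perm β)} (p : β → Prop)
    (hS : ∀ s ∈ S, ∀ x, p (s x) ↔ p x) (hG : ∀ g ∈ G, ∀ x, p (g x) ↔ p x) (hSG : S ≤ G)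
    (s : Perm β) (hs : s ∈ S) : restr S p hS ⟨s, hs⟩ = restr G p hG ⟨s, hSG hs⟩ := rfl

/-- Restriction of subgroups is monotone. -/
theorem range_restr_mono {S G : Subgroup (Perm β)} (p : β → Prop)
    (hS : ∀ s ∈ S, ∀ x, p (s x) ↔ p x) (hG : ∀ g ∈ G, ∀ x, p (g x) ↔ p x) (hSG : S ≤ G) :
    (restr S p hS).range ≤ (restr G p hG).range := by
  rintro x ⟨⟨s, hs⟩, rfl⟩
  exact ⟨⟨s, hSG hs⟩, rfl⟩

/-- A subgroup `S ≤ G` normalised by `G` restricts to a subgroup normalised by `G|_p`. -/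
theorem conj_mem_range_restr {S G : Subgroup (Perm β)} (p : β → Prop)
    (hS : ∀ s ∈ S, ∀ x, p (s x) ↔ p x) (hG : ∀ g ∈ G, ∀ x, p (g x) ↔ p x) (hSG : S ≤ G)
    (hn : ∀ g ∈ G, ∀ s ∈ S, g * s * g⁻¹ ∈ S) :
    ∀ t ∈ (restr G p hG).range, ∀ x ∈ (restr S p hS).range, t * x * t⁻¹ ∈ (restr S p hS).range := by
  rintro t ⟨⟨g, hg⟩, rfl⟩ x ⟨⟨s, hs⟩, rfl⟩
  refine ⟨⟨g * s * g⁻¹, hn g hg s hs⟩, ?_⟩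
  rw [restr_mk_eq_restr_mk p hS hG hSG s hs, restr_mk_eq_restr_mk p hS hG hSG,
    ← map_mul, ← map_inv, ← map_mul]
  rfl

/-- Commutator inclusions `[X, Y] ⊆ Z` inside `G` pass to the restrictions. -/
theorem comm_mem_range_restr {X Y Z G : Subgroup (Perm β)} (p : β → Prop)
    (hX : ∀ s ∈ X, ∀ x, p (s x) ↔ p x) (hY : ∀ s ∈ Y, ∀ x, p (s x) ↔ p x)
    (hZ : ∀ s ∈ Z, ∀ x, p (s x) ↔ p x) (hG : ∀ g ∈ G, ∀ x, p (g x) ↔ p x)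
    (hXG : X ≤ G) (hYG : Y ≤ G) (hZG : Z ≤ G)
    (hc : ∀ x ∈ X, ∀ y ∈ Y, x * y * x⁻¹ * y⁻¹ ∈ Z) :
    ∀ x ∈ (restr X p hX).range, ∀ y ∈ (restr Y p hY).range,
      x * y * x⁻¹ * y⁻¹ ∈ (restr Z p hZ).range := by
  rintro x ⟨⟨a, ha⟩, rfl⟩ y ⟨⟨b, hb⟩, rfl⟩
  refine ⟨⟨a * b * a⁻¹ * b⁻¹, hc a ha b hb⟩, ?_⟩
  rw [restr_mk_eq_restr_mk p hX hG hXG a ha, restr_mk_eq_restr_mk p hY hG hYG b hb,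
    restr_mk_eq_restr_mk p hZ hG hZG, ← map_inv, ← map_inv, ← map_mul, ← map_mul, ← map_mul]
  rfl

/-- If `G` is transitive on `{u | p u}`, its restriction is a transitive permutation group. -/
theorem isPretransitive_range_restr (G : Subgroup (Perm β)) (p : β → Prop)
    (hG : ∀ g ∈ G, ∀ x, p (g x) ↔ p x) (htr : ∀ a b, p a → p b → ∃ g ∈ G, g a = b) :
    IsPretransitive (restr G p hG).range {u // p u} :=
  ⟨fun a b => by
    obtain ⟨g, hg, e⟩ := htr a.1 b.1 a.2 b.2
    exact ⟨⟨restr G p hG ⟨g, hg⟩, ⟨_, rfl⟩⟩, Subtype.ext e⟩⟩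

/-- A permutation whose moved points satisfy `p` leaves `{u | p u}` invariant. -/
theorem prop_apply_iff_of_moved {σ : Perm β} {p : β → Prop} (h : ∀ u, σ u ≠ u → p u) (u : β) :
    p (σ u) ↔ p u := by
  by_cases hu : σ u = u
  · rw [hu]
  · have h2 : σ (σ u) ≠ σ u := fun e => hu (σ.injective e)
    exact ⟨fun _ => h u hu, fun _ => h _ h2⟩

/-- **Lifting**: a permutation supported in `{u | p u}` whose restriction lies in `S|_p`, for a
subgroup `S` fixing the complement pointwise, lies in `S`. -/
theorem mem_of_subtypePerm_mem_range (S : Subgroup (Perm β)) (p : β → Prop)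
    (hS : ∀ s ∈ S, ∀ x, p (s x) ↔ p x) (hfix : ∀ s ∈ S, ∀ u, ¬ p u → s u = u)
    (σ : Perm β) (hσp : ∀ u, p (σ u) ↔ p u) (hσ : ∀ u, σ u ≠ u → p u)
    (h : σ.subtypePerm hσp ∈ (restr S p hS).range) : σ ∈ S := by
  obtain ⟨⟨s, hs⟩, hsσ⟩ := h
  have e : s = σ := by
    ext u
    by_cases hu : p u
    · have := congrArg (fun f : Perm {u // p u} => ((f ⟨u, hu⟩ : {u // p u}) : β)) hsσ
      simpa using this
    · rw [hfix s hs u hu]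
      by_contra hne
      exact hu (hσ u (Ne.symm hne))
  rw [← e]
  exact hs

end Restriction

/-- **The general pair bound.**  For `L ≤ G ≤ Sym(β)` with `L` normalised by `G` there is a
labelling `μ : β → ℕ` (labels `< N`) such that every even permutation of `β` whose moved points
carry one label lies in `L`, and `|G| · |L| ≤ 2^{5|β|} · |β|! · ∏_{i<N} |μ⁻¹(i)|!`.
Strong induction on `|β|`; see the module docstring. -/
theorem pair_bound (n : ℕ) :
    ∀ {β : Type u} [Fintype β] [DecidableEq β], Fintype.card β = n →
      ∀ G L : Subgroup (Perm β), L ≤ G → (∀ g ∈ G, ∀ l ∈ L, g * l * g⁻¹ ∈ L) →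
      ∃ (N : ℕ) (μ : β → ℕ), (∀ u, μ u < N) ∧
        (∀ σ : Perm β, sign σ = 1 → (∀ u v, σ u ≠ u → σ v ≠ v → μ u = μ v) → σ ∈ L) ∧
        Nat.card G * Nat.card L ≤ 2 ^ (5 * n) * n.factorial *
          ∏ i ∈ Finset.range N, ((Finset.univ.filter fun u : β => μ u = i).card).factorial := by
  induction n using Nat.strong_induction_on with
  | _ n ih =>
  intro β _ _ hn G L hLG hnorm
  by_cases htrans : IsPretransitive G β
  · ---------------------------------------------------------------- transitive: layer 6
    obtain ⟨N, μ, hμ, hmem, hbound⟩ := est_transitive_pair_bound G G L L htrans le_rfl hLG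
      (fun t ht x hx => G.mul_mem (G.mul_mem ht hx) (G.inv_mem ht)) hnorm hnorm
      (fun x hx y hy => L.mul_mem (hnorm x hx y hy) (L.inv_mem hy))
    exact ⟨N, μ, hμ, hmem, hn ▸ hbound⟩
  ------------------------------------------------------------------ intransitive: split along an orbit
  classical
  obtain ⟨x₀, y₀, hxy⟩ : ∃ x y : β, ∀ g ∈ G, g x ≠ y := by
    by_contra h
    push Not at h
    exact htrans ⟨fun a b => by
      obtain ⟨g, hg, e⟩ := h a b
      exact ⟨⟨g, hg⟩, e⟩⟩
  set O : Finset β := Finset.univ.filter fun u => ∃ g ∈ G, g x₀ = u with hO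
  have hmemO : ∀ u, u ∈ O ↔ ∃ g ∈ G, g x₀ = u := fun u => by simp [hO]
  have hx₀O : x₀ ∈ O := (hmemO x₀).2 ⟨1, G.one_mem, rfl⟩
  have hy₀O : y₀ ∉ O := fun h => by
    obtain ⟨g, hg, e⟩ := (hmemO y₀).1 h
    exact hxy g hg e
  -- invariance of `O` under `G` and its subgroups
  have hGp : ∀ g ∈ G, ∀ u, g u ∈ O ↔ u ∈ O := by
    intro g hg u
    rw [hmemO, hmemO]
    constructor
    · rintro ⟨h, hh, e⟩
      refine ⟨g⁻¹ * h, G.mul_mem (G.inv_mem hg) hh, ?_⟩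
      rw [Perm.mul_apply, e, perm_inv_apply_self]
    · rintro ⟨h, hh, e⟩
      exact ⟨g * h, G.mul_mem hg hh, by rw [Perm.mul_apply, e]⟩
  have hGq : ∀ g ∈ G, ∀ u, g u ∉ O ↔ u ∉ O := fun g hg u => not_congr (hGp g hg u)
  have htrO : ∀ a b, a ∈ O → b ∈ O → ∃ g ∈ G, g a = b := by
    intro a b ha hb
    obtain ⟨g₁, hg₁, rfl⟩ := (hmemO a).1 ha
    obtain ⟨g₂, hg₂, rfl⟩ := (hmemO b).1 hb
    exact ⟨g₂ * g₁⁻¹, G.mul_mem hg₂ (G.inv_mem hg₁), by rw [Perm.mul_apply, perm_inv_apply_self]⟩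
  -- the four auxiliary subgroups
  set GO := G ⊓ fixingSubgroup (Perm β) {u | u ∉ O} with hGO   -- supported in `O`
  set M := L ⊓ fixingSubgroup (Perm β) {u | u ∉ O} with hM      -- `L`, supported in `O`
  set Nn := L ⊓ fixingSubgroup (Perm β) {u | u ∈ O} with hNn    -- `L`, supported off `O`
  have hmemGO : ∀ g, g ∈ GO ↔ g ∈ G ∧ ∀ u, u ∉ O → g u = u := fun g => by
    rw [hGO, Subgroup.mem_inf, mem_fixingSubgroup_iff]; rfl
  have hmemM : ∀ g, g ∈ M ↔ g ∈ L ∧ ∀ u, u ∉ O → g u = u := fun g => by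
    rw [hM, Subgroup.mem_inf, mem_fixingSubgroup_iff]; rfl
  have hmemNn : ∀ g, g ∈ Nn ↔ g ∈ L ∧ ∀ u, u ∈ O → g u = u := fun g => by
    rw [hNn, Subgroup.mem_inf, mem_fixingSubgroup_iff]; rfl
  have hGOG : GO ≤ G := inf_le_left
  have hML : M ≤ L := inf_le_left
  have hMG : M ≤ G := hML.trans hLG
  have hNnL : Nn ≤ L := inf_le_left
  have hNnG : Nn ≤ G := hNnL.trans hLG
  have hLp : ∀ s ∈ L, ∀ u, s u ∈ O ↔ u ∈ O := fun s hs => hGp s (hLG hs)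
  have hGOp : ∀ s ∈ GO, ∀ u, s u ∈ O ↔ u ∈ O := fun s hs => hGp s (hGOG hs)
  have hMp : ∀ s ∈ M, ∀ u, s u ∈ O ↔ u ∈ O := fun s hs => hGp s (hMG hs)
  have hNnq : ∀ s ∈ Nn, ∀ u, s u ∉ O ↔ u ∉ O := fun s hs => hGq s (hNnG hs)
  -- conjugation by `G` preserves "fixes the complement of `O`" and "fixes `O`"
  have hconj_off : ∀ g ∈ G, ∀ s : Perm β, (∀ u, u ∉ O → s u = u) →
      ∀ u, u ∉ O → (g * s * g⁻¹) u = u := by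
    intro g hg s hs u hu
    have h1 : g⁻¹ u ∉ O := (hGq g⁻¹ (G.inv_mem hg) u).2 hu
    rw [Perm.mul_apply, Perm.mul_apply, hs _ h1, perm_apply_inv_self]
  have hconj_on : ∀ g ∈ G, ∀ s : Perm β, (∀ u, u ∈ O → s u = u) →
      ∀ u, u ∈ O → (g * s * g⁻¹) u = u := by
    intro g hg s hs u hu
    have h1 : g⁻¹ u ∈ O := (hGp g⁻¹ (G.inv_mem hg) u).2 hu
    rw [Perm.mul_apply, Perm.mul_apply, hs _ h1, perm_apply_inv_self]
  have nGO : ∀ g ∈ G, ∀ s ∈ GO, g * s * g⁻¹ ∈ GO := by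
    intro g hg s hs
    rw [hmemGO] at hs ⊢
    exact ⟨G.mul_mem (G.mul_mem hg hs.1) (G.inv_mem hg), hconj_off g hg s hs.2⟩
  have nM : ∀ g ∈ G, ∀ s ∈ M, g * s * g⁻¹ ∈ M := by
    intro g hg s hs
    rw [hmemM] at hs ⊢
    exact ⟨hnorm g hg s hs.1, hconj_off g hg s hs.2⟩
  have nNn : ∀ g ∈ G, ∀ s ∈ Nn, g * s * g⁻¹ ∈ Nn := by
    intro g hg s hs
    rw [hmemNn] at hs ⊢
    exact ⟨hnorm g hg s hs.1, hconj_on g hg s hs.2⟩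
  -- commutators `[L, GO] ⊆ M`
  have hcomm : ∀ l ∈ L, ∀ g ∈ GO, l * g * l⁻¹ * g⁻¹ ∈ M := by
    intro l hl g hg
    obtain ⟨hgG, hgoff⟩ := (hmemGO g).1 hg
    rw [hmemM]
    refine ⟨?_, fun u hu => ?_⟩
    · have h1 : g * l⁻¹ * g⁻¹ ∈ L := hnorm g hgG l⁻¹ (L.inv_mem hl)
      have e : l * g * l⁻¹ * g⁻¹ = l * (g * l⁻¹ * g⁻¹) := by group
      rw [e]
      exact L.mul_mem hl h1
    · have h1 := hconj_off l (hLG hl) g hgoff u hu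
      have h2 : g⁻¹ u = u := by
        rw [Perm.inv_eq_iff_eq]
        exact (hgoff u hu).symm
      rw [Perm.mul_apply, h2, h1]
  ------------------------------------------------------------------ the `O` side (layer 6)
  haveI hT : IsPretransitive (restr G (fun u => u ∈ O) hGp).range {u // u ∈ O} :=
    isPretransitive_range_restr G (fun u => u ∈ O) hGp htrO
  obtain ⟨N₁, μ₁, hμ₁, hmem₁, hbound₁⟩ := est_transitive_pair_bound
    (restr G (fun u => u ∈ O) hGp).range (restr L (fun u => u ∈ O) hLp).range (restr GO (fun u => u ∈ O) hGOp).range (restr M (fun u => u ∈ O) hMp).range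
    hT (range_restr_mono (fun u => u ∈ O) hLp hGp hLG) (range_restr_mono (fun u => u ∈ O) hGOp hGp hGOG)
    (conj_mem_range_restr (fun u => u ∈ O) hLp hGp hLG hnorm) (conj_mem_range_restr (fun u => u ∈ O) hGOp hGp hGOG nGO)
    (conj_mem_range_restr (fun u => u ∈ O) hMp hGp hMG nM)
    (comm_mem_range_restr (fun u => u ∈ O) hLp hGOp hMp hGp hLG hGOG hMG hcomm)
  ------------------------------------------------------------------ the complement side (induction)
  have hd : Fintype.card {u // u ∈ O} = O.card := Fintype.card_coe O
  have hdpos : 0 < O.card := Finset.card_pos.2 ⟨x₀, hx₀O⟩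
  have hm : Fintype.card {u // u ∉ O} = n - O.card := by
    have h1 : Fintype.card {u // u ∉ O} = (Finset.univ.filter fun u => u ∉ O).card :=
      Fintype.card_subtype _
    have h2 : (Finset.univ.filter fun u => u ∉ O) = Finset.univ \ O := by
      ext u; simp
    rw [h1, h2, Finset.card_sdiff_of_subset (Finset.subset_univ O), Finset.card_univ, hn]
  have hdle : O.card ≤ n := hn ▸ Finset.card_le_univ O
  have hmlt : n - O.card < n := Nat.sub_lt (by omega) hdpos
  obtain ⟨N₂, μ₂, hμ₂, hmem₂, hbound₂⟩ := ih (n - O.card) hmlt hm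
    (restr G (fun u => u ∉ O) hGq).range (restr Nn (fun u => u ∉ O) hNnq).range (range_restr_mono (fun u => u ∉ O) hNnq hGq hNnG)
    (conj_mem_range_restr (fun u => u ∉ O) hNnq hGq hNnG nNn)
  ------------------------------------------------------------------ glue the labellings
  obtain ⟨μ, hμN, hμO, hμC, hprod⟩ := exists_combined_labelling O N₁ N₂ μ₁ μ₂ hμ₁ hμ₂
  refine ⟨N₁ + N₂, μ, hμN, ?_, ?_⟩
  · ---------------------------------------------------------------- membership
    intro σ hσ hmono
    by_cases h1 : σ = 1
    · rw [h1]; exact L.one_mem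
    obtain ⟨u₀, hu₀⟩ : ∃ u, σ u ≠ u := by
      by_contra h
      push Not at h
      exact h1 (Equiv.ext h)
    by_cases hu₀O : u₀ ∈ O
    · -- supported in `O`: lift through `M`
      have hsupp : ∀ v, σ v ≠ v → v ∈ O := by
        intro v hv
        by_contra hvO
        have e := hmono v u₀ hv hu₀
        rw [hμC v hvO, hμO u₀ hu₀O] at e
        have := hμ₁ ⟨u₀, hu₀O⟩
        omega
      have hσp : ∀ u, σ u ∈ O ↔ u ∈ O := prop_apply_iff_of_moved hsupp
      have hsign : sign (σ.subtypePerm hσp) = 1 := by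
        have h := sign_subtypePerm σ hσp hsupp
        rw [hσ] at h
        convert h using 3
      have hmonoO : ∀ a b : {u // u ∈ O}, σ.subtypePerm hσp a ≠ a → σ.subtypePerm hσp b ≠ b →
          μ₁ a = μ₁ b := by
        intro a b ha hb
        have ha' : σ a.1 ≠ a.1 := fun e => ha (Subtype.ext e)
        have hb' : σ b.1 ≠ b.1 := fun e => hb (Subtype.ext e)
        have e := hmono a.1 b.1 ha' hb'
        rwa [hμO a.1 a.2, hμO b.1 b.2] at e
      have hZ := hmem₁ _ hsign hmonoO
      exact hML (mem_of_subtypePerm_mem_range M (fun u => u ∈ O) hMp (fun s hs => ((hmemM s).1 hs).2) σ hσp hsupp hZ)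
    · -- supported off `O`: lift through `Nn`
      have hsupp : ∀ v, σ v ≠ v → v ∉ O := by
        intro v hv hvO
        have e := hmono v u₀ hv hu₀
        rw [hμO v hvO, hμC u₀ hu₀O] at e
        have := hμ₁ ⟨v, hvO⟩
        omega
      have hσq : ∀ u, σ u ∉ O ↔ u ∉ O := prop_apply_iff_of_moved hsupp
      have hsign : sign (σ.subtypePerm (p := fun u => u ∉ O) hσq) = 1 := by
        have h := sign_subtypePerm σ (p := fun u => u ∉ O) hσq hsupp
        rw [hσ] at h
        convert h using 3
      have hmonoC : ∀ a b : {u // u ∉ O}, σ.subtypePerm (p := fun u => u ∉ O) hσq a ≠ a →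
          σ.subtypePerm (p := fun u => u ∉ O) hσq b ≠ b →
          μ₂ a = μ₂ b := by
        intro a b ha hb
        have ha' : σ a.1 ≠ a.1 := fun e => ha (Subtype.ext e)
        have hb' : σ b.1 ≠ b.1 := fun e => hb (Subtype.ext e)
        have e := hmono a.1 b.1 ha' hb'
        rw [hμC a.1 a.2, hμC b.1 b.2] at e
        simp only [Subtype.coe_eta] at e
        omega
      have hZ := hmem₂ _ hsign hmonoC
      exact hNnL (mem_of_subtypePerm_mem_range Nn (fun u => u ∉ O) hNnq
        (fun s hs u hu => ((hmemNn s).1 hs).2 u (not_not.1 hu)) σ hσq hsupp hZ)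
  · ---------------------------------------------------------------- the count
    -- `|L| = |Nn| · |L|_O|`, `|G| = |GO| · |G|_{Oᶜ}|`, `|GO|_O| = |GO|`, `|Nn|_{Oᶜ}| = |Nn|`
    have hL : Nat.card L = Nat.card Nn * Nat.card (restr L (fun u => u ∈ O) hLp).range :=
      card_eq_card_inf_fixing_mul_card_range L (fun u => u ∈ O) hLp
    have hG : Nat.card G = Nat.card GO * Nat.card (restr G (fun u => u ∉ O) hGq).range :=
      card_eq_card_inf_fixing_mul_card_range G (fun u => u ∉ O) hGq
    have hY : Nat.card (restr GO (fun u => u ∈ O) hGOp).range = Nat.card GO :=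
      card_range_restr_of_fix_compl GO (fun u => u ∈ O) hGOp fun s hs u hu => ((hmemGO s).1 hs).2 u hu
    have hL₂ : Nat.card (restr Nn (fun u => u ∉ O) hNnq).range = Nat.card Nn :=
      card_range_restr_of_fix_compl Nn (fun u => u ∉ O) hNnq fun s hs u hu => ((hmemNn s).1 hs).2 u (not_not.1 hu)
    rw [hd] at hbound₁
    set d := O.card with hdd
    set P₁ := ∏ i ∈ Finset.range N₁,
      ((Finset.univ.filter fun v : {x // x ∈ O} => μ₁ v = i).card).factorial with hP₁
    set P₂ := ∏ i ∈ Finset.range N₂,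
      ((Finset.univ.filter fun v : {x // x ∉ O} => μ₂ v = i).card).factorial with hP₂
    have hfac : d.factorial * (n - d).factorial ≤ n.factorial := by
      have := Nat.factorial_mul_factorial_dvd_factorial_add d (n - d)
      rw [Nat.add_sub_cancel' hdle] at this
      exact Nat.le_of_dvd (Nat.factorial_pos n) this
    have hpow : 2 ^ (5 * d) * 2 ^ (5 * (n - d)) = 2 ^ (5 * n) := by
      rw [← pow_add]
      congr 1
      omega
    rw [hprod]
    calc Nat.card G * Nat.card L
        = (Nat.card (restr L (fun u => u ∈ O) hLp).range * Nat.card (restr GO (fun u => u ∈ O) hGOp).range) *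
            (Nat.card (restr G (fun u => u ∉ O) hGq).range * Nat.card (restr Nn (fun u => u ∉ O) hNnq).range) := by
          rw [hL, hG, hY, hL₂]; ring
      _ ≤ (2 ^ (5 * d) * d.factorial * P₁) * (2 ^ (5 * (n - d)) * (n - d).factorial * P₂) :=
          Nat.mul_le_mul hbound₁ hbound₂
      _ = (2 ^ (5 * d) * 2 ^ (5 * (n - d))) * (d.factorial * (n - d).factorial) * (P₁ * P₂) := by
          ring
      _ ≤ 2 ^ (5 * n) * n.factorial * (P₁ * P₂) := by
          rw [hpow]
          exact Nat.mul_le_mul_right _ (Nat.mul_le_mul_left _ hfac)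

end EST

open EST in
/-- **Entropy support theorem** (registered stub `entropySupportTheorem` of crux
`SymmetryBudget.WindowBarrier`, item stmt-PneNP-2145): for every `c` there is `K` (namely
`K = 2c + 5`) such that every subgroup `H ≤ Sym(Fin n)` of index `≤ 2^{cn}` admits a labelling
`μ` of `Fin n` with `n! ≤ 2^{Kn} · ∏_{labels} |class|!` (the multinomial of the classes is
`≤ 2^{Kn}`) and with every 3-cycle inside a class in `H` (so `H ⊇ ∏ Alt(class)`).  From
`EST.pair_bound` with `G = L = H`: `(n!)² = ([Sym : H]·|H|)² ≤ 2^{2cn}·|H|² ≤ 2^{2cn}·2^{5n}·n!·∏`. -/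
theorem entropySupportTheorem :
    ∀ c : ℕ, ∃ K : ℕ, ∀ (n : ℕ) (H : Subgroup (Equiv.Perm (Fin n))), H.index ≤ 2 ^ (c * n) →
      ∃ μ : Fin n → ℕ, n.factorial ≤ 2 ^ (K * n) *
          ∏ i ∈ Finset.univ.image μ, ((Finset.univ.filter fun u : Fin n => μ u = i).card).factorial ∧
        ∀ u v w : Fin n, u ≠ v → v ≠ w → u ≠ w → μ u = μ v → μ v = μ w →
          Equiv.swap u v * Equiv.swap v w ∈ H := by
  intro c
  refine ⟨2 * c + 5, fun n H hidx => ?_⟩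
  obtain ⟨N, μ, -, hmem, hbound⟩ := pair_bound n (Fintype.card_fin n) H H le_rfl
    (fun g hg l hl => H.mul_mem (H.mul_mem hg hl) (H.inv_mem hg))
  refine ⟨μ, ?_, ?_⟩
  · set P := ∏ i ∈ Finset.range N, ((Finset.univ.filter fun u : Fin n => μ u = i).card).factorial
      with hP
    have hPimg := prod_range_le_prod_image μ N
    have hcard : H.index * Nat.card H = n.factorial := by
      rw [Subgroup.index_mul_card, Nat.card_perm, Nat.card_eq_fintype_card, Fintype.card_fin]
    have h1 : n.factorial ≤ 2 ^ (c * n) * Nat.card H := by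
      rw [← hcard]; exact Nat.mul_le_mul_right _ hidx
    have h2 : n.factorial * n.factorial ≤ (2 ^ (c * n) * 2 ^ (c * n) * 2 ^ (5 * n) * P) * n.factorial :=
      calc n.factorial * n.factorial ≤ (2 ^ (c * n) * Nat.card H) * (2 ^ (c * n) * Nat.card H) :=
            Nat.mul_le_mul h1 h1
        _ = 2 ^ (c * n) * 2 ^ (c * n) * (Nat.card H * Nat.card H) := by ring
        _ ≤ 2 ^ (c * n) * 2 ^ (c * n) * (2 ^ (5 * n) * n.factorial * P) := Nat.mul_le_mul_left _ hbound
        _ = (2 ^ (c * n) * 2 ^ (c * n) * 2 ^ (5 * n) * P) * n.factorial := by ring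
    have h3 : n.factorial ≤ 2 ^ (c * n) * 2 ^ (c * n) * 2 ^ (5 * n) * P :=
      Nat.le_of_mul_le_mul_right h2 (Nat.factorial_pos n)
    have hpow : 2 ^ (c * n) * 2 ^ (c * n) * 2 ^ (5 * n) = 2 ^ ((2 * c + 5) * n) := by
      rw [← pow_add, ← pow_add]; congr 1; ring
    calc n.factorial ≤ 2 ^ (c * n) * 2 ^ (c * n) * 2 ^ (5 * n) * P := h3
      _ = 2 ^ ((2 * c + 5) * n) * P := by rw [hpow]
      _ ≤ 2 ^ ((2 * c + 5) * n) * _ := Nat.mul_le_mul_left _ hPimg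
  · intro u v w huv hvw huw hμuv hμvw
    apply hmem
    · rw [Perm.sign_mul, Perm.sign_swap huv, Perm.sign_swap hvw]; decide
    · intro a b ha hb
      have key : ∀ x, (Equiv.swap u v * Equiv.swap v w) x ≠ x → μ x = μ u := by
        intro x hx
        by_cases hxu : x = u
        · rw [hxu]
        by_cases hxv : x = v
        · rw [hxv, hμuv]
        by_cases hxw : x = w
        · rw [hxw, ← hμvw, hμuv]
        exfalso
        apply hx
        rw [Perm.mul_apply, swap_apply_of_ne_of_ne hxv hxw, swap_apply_of_ne_of_ne hxu hxv]
      rw [key a ha, key b hb]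

end Summit.PneNP.PneNP.Theorems
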